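import Literature.Probability.RandomPlanarGeometry.LoewnerCotArgExit
import Literature.Probability.RandomPlanarGeometry.SLEKappaRhoSchrammObservable
import Mathlib.Analysis.SpecialFunctions.BinaryEntropy
import HarnessLib

/-!
# The room stop of a chordal Loewner flow and the boundedness of the stopped room–entropy combination

Topic `Literature/Probability/RandomPlanarGeometry`; companion of `LoewnerCotArgExit.lean` (the
centred flow `z_t = g_t(z) - W_t = Loewner.centredMap`, Rohde–Schramm's ratio
`ψ_t = (Im z) |g_t'(z)| / Im g_t(z) = Loewner.derivRatio`, `ψ_t = exp ∫₀ᵗ 4y²/|z|⁴`,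
`∫₀ᵗ 2/|z_u|² du = log Im z - log Im z_t`), of `SLEKappaRhoSchrammObservable.lean` (Schramm's
observable `S_t = (1 + Re z_t/|z_t|)/2 = Loewner.schrammObs ∈ [0, 1]`) and of
`LoewnerRoomObservableFarField.lean` (far-field expansion and continuity in time of the stopped
room–entropy combination). It supplies the GLOBAL a-priori bounds of the room–entropy combination

  `N_t(z) = log ψ_t(z) + 3 H(S_t(z))`,  `H` = binary entropy in nats (`Real.binEntropy`),

stopped at the **room stop** `τ^{z,m} = inf ({u | Im z_u ≤ Im z/(m+1)} ∪ {m+1})` (the first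
time the imaginary part of the centred flow has dropped by the factor `m + 1`, capped at
`m + 1`; the spelling of the summit-side line `room-entropy-wright-fisher` of
`SAWScalingLimit/SubseqIdentification`, whose `roomStop`, `roomObsStopped` unfold to the
expressions used here), for EVERY continuous driving function — the integrability input of every
martingale statement about `N^{z,m}_t = N_{t ∧ τ^{z,m}}(z)`:

* `derivRatioRate_le_two_mul_two_div_normSq` — the pointwise comparison of Rohde–Schramm's two
  rates, `4 y²/|z|⁴ ≤ 2 · (2/|z|²)` (`y ≤ |z|`);
* **`log_derivRatio_le_two_mul`**, **`derivRatio_le_sq`** — `log ψ_t ≤ 2 (log Im z - log Im z_t)`,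
  i.e. `ψ_t ≤ (Im z / Im z_t)²` for `t < T_z`: the loss of log conformal radius seen from `z` is
  at most twice the logarithmic drop of the height of the flow (with `1 ≤ ψ_t`,
  `one_le_derivRatio`, this pins `log ψ` between `0` and `2 log (Im z / Im z_t)`);
* `roomStop_le`, **`coe_roomStop_lt_swallowingTime`**, `lt_im_centredMap_of_lt_roomStop`,
  **`div_le_im_centredMap_of_le_roomStop`** — the room stop is at most `m + 1`, is strictly
  before the swallowing time `T_z`, and up to and including it the height of the flow is at least
  `Im z/(m+1)`;
* **`log_derivRatio_min_roomStop_mem_Icc`** — `0 ≤ log ψ_{t ∧ τ} ≤ 2 log (m+1)`;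
* **`roomObs_min_roomStop_mem_Icc`**, `abs_roomObs_min_roomStop_le` —
  `0 ≤ N_{t ∧ τ}(z) ≤ 2 log (m+1) + 3 log 2` (`0 ≤ H ≤ log 2` on `[0, 1]`), uniformly in the
  driving function and in `z ∈ ℍ`.

Everything is proved; no definition and no named fact is introduced.

## References

* S. Rohde, O. Schramm, *Basic properties of SLE*, Ann. of Math. 161 (2005), eq. (3.4) and
  eq. (6.3), proof of Lemma 6.3 (p. 904–905: `ψ_t`, `z_t`, the stopping times `t_n < τ(ẑ)`).
* G. F. Lawler, *Conformally Invariant Processes in the Plane*, AMS (2005), §4.1 (the flow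
  `∂_t Im g_t = -2 Im g_t/|g_t - U_t|²`).
* O. Schramm, *A percolation formula*, Electron. Comm. Probab. 6 (2001), Thm. 2 (`S_t`).
-/

noncomputable section

open Set Filter Topology Metric MeasureTheory Complex
open scoped NNReal

namespace Literature.Probability.RandomPlanarGeometry

namespace Loewner

variable {W : ℝ≥0 → ℝ} {z : ℂ}

/-! ### `ψ_t ≤ (Im z / Im z_t)²` -/

/-- **Comparison of Rohde–Schramm's two rates**: `4 y_u²/|z_u|⁴ ≤ 2 · (2/|z_u|²)` at every real
time `u` (`y_u² ≤ |z_u|²`; both sides vanish at the junk value `z_u = 0`). [folklore] -/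
theorem derivRatioRate_le_two_mul_two_div_normSq (W : ℝ≥0 → ℝ) (z : ℂ) (u : ℝ) :
    derivRatioRate W z u ≤ 2 * (2 / Complex.normSq (centredMap W u.toNNReal z)) := by
  rw [derivRatioRate_eq_centredMap]
  set Z := centredMap W u.toNNReal z with hZ
  rcases eq_or_ne Z 0 with h0 | h0
  · simp [h0]
  · have hn : 0 < ‖Z‖ := norm_pos_iff.2 h0
    have hnsq : Complex.normSq Z = ‖Z‖ ^ 2 := by
      rw [Complex.normSq_eq_norm_sq]
    rw [hnsq]
    have him : Z.im ^ 2 ≤ ‖Z‖ ^ 2 := by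
      have h1 : |Z.im| ≤ ‖Z‖ := Complex.abs_im_le_norm Z
      have h2 : 0 ≤ |Z.im| := abs_nonneg _
      calc Z.im ^ 2 = |Z.im| ^ 2 := (sq_abs _).symm
        _ ≤ ‖Z‖ ^ 2 := pow_le_pow_left₀ h2 h1 2
    have h4 : (0 : ℝ) < ‖Z‖ ^ 4 := by positivity
    have h2' : (0 : ℝ) < ‖Z‖ ^ 2 := by positivity
    rw [div_le_iff₀ h4, show 2 * (2 / ‖Z‖ ^ 2) * ‖Z‖ ^ 4 = 4 * ‖Z‖ ^ 2 by field_simp; ring]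
    nlinarith

/-- **`log ψ_t ≤ 2 (log Im z - log Im z_t)`** for a continuous driving function, `z ∈ ℍ` and
`t < T_z`: by Rohde–Schramm's (6.3), `log ψ_t = ∫₀ᵗ 4y²/|z|⁴`, the rate comparison
`4y²/|z|⁴ ≤ 2 · 2/|z|²`, and (3.4) in logarithmic form, `∫₀ᵗ 2/|z_u|² = log Im z - log Im z_t`
(`integral_two_div_normSq_eq_log`). [cite: RohdeSchramm2005, eq. (6.3)] -/
theorem log_derivRatio_le_two_mul (hW : Continuous W) (hz : 0 < z.im) {t : ℝ≥0}
    (ht : (t : WithTop ℝ≥0) < swallowingTime W z) :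
    Real.log (derivRatio W z t) ≤ 2 * (Real.log z.im - Real.log (centredMap W t z).im) := by
  rw [derivRatio_eq_exp hW hz ht, Real.log_exp, ← integral_two_div_normSq_eq_log hW hz ht,
    ← intervalIntegral.integral_const_mul]
  -- integrability of the two rates on `[0, t]`
  have hzW : z ≠ W 0 := ne_driving_of_im_pos hz 0
  have hsub : ∀ u ∈ Icc (0 : ℝ) t, ((u.toNNReal : ℝ≥0) : WithTop ℝ≥0) < swallowingTime W z := by
    intro u hu
    refine lt_of_le_of_lt (WithTop.coe_le_coe.2 ?_) ht
    rw [← NNReal.coe_le_coe, Real.coe_toNNReal _ hu.1]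
    exact hu.2
  have hZc : ContinuousOn (fun u : ℝ ↦ centredMap W u.toNNReal z) (Icc (0 : ℝ) t) :=
    (continuousOn_centredMap hW hzW).comp continuous_real_toNNReal.continuousOn
      fun u hu ↦ hsub u hu
  have hZ0 : ∀ u ∈ Icc (0 : ℝ) t, Complex.normSq (centredMap W u.toNNReal z) ≠ 0 := fun u hu ↦
    (Complex.normSq_pos.2 (centredMap_ne_zero hW hz (hsub u hu))).ne'
  have hB : IntervalIntegrable
      (fun u : ℝ ↦ 2 * (2 / Complex.normSq (centredMap W u.toNNReal z))) volume 0 t := by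
    refine (ContinuousOn.mono ?_ (by rw [uIcc_of_le t.coe_nonneg])).intervalIntegrable
    exact continuousOn_const.mul (continuousOn_const.div
      (Complex.continuous_normSq.comp_continuousOn hZc) hZ0)
  refine intervalIntegral.integral_mono_on t.coe_nonneg (intervalIntegrable_derivRatioRate hW ht)
    hB fun u _ ↦ derivRatioRate_le_two_mul_two_div_normSq W z u

/-- **`ψ_t ≤ (Im z / Im z_t)²`** for a continuous driving function, `z ∈ ℍ`, `t < T_z`
(exponentiating `log_derivRatio_le_two_mul`): together with `1 ≤ ψ_t` (`one_le_derivRatio`),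
the ratio `ψ_t = (Im z)|g_t'(z)|/Im g_t(z)` is pinned between `1` and the squared height drop
of the flow. [cite: RohdeSchramm2005, eq. (6.3)] -/
theorem derivRatio_le_sq (hW : Continuous W) (hz : 0 < z.im) {t : ℝ≥0}
    (ht : (t : WithTop ℝ≥0) < swallowingTime W z) :
    derivRatio W z t ≤ (z.im / (centredMap W t z).im) ^ 2 := by
  have hy : 0 < (centredMap W t z).im := im_centredMap_pos hW hz ht
  have hψ : 0 < derivRatio W z t := lt_of_lt_of_le one_pos (one_le_derivRatio hW hz ht)
  have hlog := log_derivRatio_le_two_mul hW hz ht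
  rw [← Real.log_div hz.ne' hy.ne', ← Real.log_rpow (div_pos hz hy)] at hlog
  have h2 : (z.im / (centredMap W t z).im) ^ (2 : ℝ) = (z.im / (centredMap W t z).im) ^ 2 := by
    rw [← Real.rpow_natCast]
    norm_num
  rw [h2] at hlog
  exact (Real.log_le_log_iff hψ (by positivity)).1 hlog

/-! ### The room stop -/

section RoomStop

variable (W z)

/-- The room stop is at most its cap `m + 1`. [folklore] -/
theorem roomStop_le (m : ℕ) :
    sInf ({u : ℝ≥0 | (centredMap W u z).im ≤ z.im / ((m : ℝ) + 1)} ∪ {(m : ℝ≥0) + 1}) ≤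
      (m : ℝ≥0) + 1 :=
  csInf_le (OrderBot.bddBelow _) (Or.inr rfl)

/-- Strictly before the room stop the height of the centred flow exceeds the level
`Im z/(m+1)`. [folklore] -/
theorem lt_im_centredMap_of_lt_roomStop (m : ℕ) {u : ℝ≥0}
    (hu : u < sInf ({u : ℝ≥0 | (centredMap W u z).im ≤ z.im / ((m : ℝ) + 1)} ∪ {(m : ℝ≥0) + 1})) :
    z.im / ((m : ℝ) + 1) < (centredMap W u z).im := by
  by_contra h
  rw [not_lt] at h
  exact lt_irrefl _ (hu.trans_le (csInf_le (OrderBot.bddBelow _) (Or.inl h)))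

variable {W z}

/-- **The room stop is strictly before the swallowing time** `T_z` (`W` continuous, `Im z > 0`):
if `T_z < ∞` then `Im z_t → 0` as `t ↑ T_z` (`exists_forall_im_centredMap_lt`), so the level
`Im z/(m+1) > 0` is reached strictly before `T_z`; if `T_z = ∞` the cap `m + 1` is finite.
Rohde–Schramm (2005), proof of Lemma 6.3 (p. 905): "an increasing sequence of stopping times
`t_n < τ(ẑ)`". [cite: RohdeSchramm2005, Lemma 6.3] -/
theorem coe_roomStop_lt_swallowingTime (hW : Continuous W) (hz : 0 < z.im) (m : ℕ) :
    ((sInf ({u : ℝ≥0 | (centredMap W u z).im ≤ z.im / ((m : ℝ) + 1)} ∪ {(m : ℝ≥0) + 1}) : ℝ≥0) :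
      WithTop ℝ≥0) < swallowingTime W z := by
  cases hT : swallowingTime W z with
  | top => exact WithTop.coe_lt_top _
  | coe b =>
    have hε : 0 < z.im / ((m : ℝ) + 1) := by positivity
    obtain ⟨t₀, ht₀T, ht₀⟩ := exists_forall_im_centredMap_lt hW hz hT hε
    have hlt := ht₀ t₀ le_rfl ht₀T
    rw [hT] at ht₀T
    have hmem : t₀ ∈ {u : ℝ≥0 | (centredMap W u z).im ≤ z.im / ((m : ℝ) + 1)} ∪ {(m : ℝ≥0) + 1} :=
      Or.inl hlt.le
    exact lt_of_le_of_lt (WithTop.coe_le_coe.2 (csInf_le (OrderBot.bddBelow _) hmem)) ht₀T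

/-- Every time up to the room stop is strictly before the swallowing time. [folklore] -/
theorem coe_lt_swallowingTime_of_le_roomStop (hW : Continuous W) (hz : 0 < z.im) (m : ℕ)
    {u : ℝ≥0}
    (hu : u ≤ sInf ({u : ℝ≥0 | (centredMap W u z).im ≤ z.im / ((m : ℝ) + 1)} ∪ {(m : ℝ≥0) + 1})) :
    (u : WithTop ℝ≥0) < swallowingTime W z :=
  lt_of_le_of_lt (WithTop.coe_le_coe.2 hu) (coe_roomStop_lt_swallowingTime hW hz m)

/-- **Up to and including the room stop the height of the flow is at least `Im z/(m+1)`**: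
strictly before, by definition; at the room stop itself by continuity of `t ↦ Im z_t` on
`[0, T_z)` from the left (at time `0`, `Im z_0 = Im z`). [folklore] -/
theorem div_le_im_centredMap_of_le_roomStop (hW : Continuous W) (hz : 0 < z.im) (m : ℕ)
    {u : ℝ≥0}
    (hu : u ≤ sInf ({u : ℝ≥0 | (centredMap W u z).im ≤ z.im / ((m : ℝ) + 1)} ∪ {(m : ℝ≥0) + 1})) :
    z.im / ((m : ℝ) + 1) ≤ (centredMap W u z).im := by
  set τ := sInf ({u : ℝ≥0 | (centredMap W u z).im ≤ z.im / ((m : ℝ) + 1)} ∪ {(m : ℝ≥0) + 1})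
    with hτdef
  set L := z.im / ((m : ℝ) + 1) with hL
  rcases hu.lt_or_eq with hlt | heq
  · exact (lt_im_centredMap_of_lt_roomStop W z m hlt).le
  · -- at the room stop: continuity from the left
    rcases eq_or_ne τ 0 with h0 | h0
    · have hzW : z ≠ W 0 := ne_driving_of_im_pos hz 0
      rw [heq, h0, centredMap_zero hW hzW, Complex.sub_im, Complex.ofReal_im, sub_zero, hL]
      refine div_le_self hz.le ?_
      have : (0 : ℝ) ≤ m := Nat.cast_nonneg m
      linarith
    · by_contra hcon
      rw [not_le] at hcon
      have hzW : z ≠ W 0 := ne_driving_of_im_pos hz 0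
      have hτT : (τ : WithTop ℝ≥0) < swallowingTime W z := coe_roomStop_lt_swallowingTime hW hz m
      -- continuity of the height at `τ` within `[0, T_z)`
      have hc : ContinuousWithinAt (fun t : ℝ≥0 ↦ (centredMap W t z).im)
          {t | (t : WithTop ℝ≥0) < swallowingTime W z} τ :=
        Complex.continuous_im.continuousAt.comp_continuousWithinAt
          ((continuousOn_centredMap hW hzW) τ hτT)
      have hev : ∀ᶠ t in 𝓝[{t | (t : WithTop ℝ≥0) < swallowingTime W z}] τ,
          (centredMap W t z).im < L := by
        have huτ : (centredMap W u z).im = (centredMap W τ z).im := by rw [heq]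
        rw [huτ] at hcon
        exact hc (Iio_mem_nhds hcon)
      -- points of `[0, τ)` close to `τ` lie in the domain
      have hIio : ∀ᶠ t in 𝓝[Iio τ] τ, (centredMap W t z).im < L := by
        refine nhdsWithin_mono τ (fun t (ht : t < τ) ↦ ?_) hev
        exact lt_of_le_of_lt (WithTop.coe_le_coe.2 ht.le) hτT
      have hne : (𝓝[Iio τ] τ).NeBot := nhdsLT_neBot_of_exists_lt ⟨0, pos_iff_ne_zero.2 h0⟩
      obtain ⟨t, htL, htτ⟩ := (hIio.and self_mem_nhdsWithin).exists
      exact lt_irrefl _ ((lt_im_centredMap_of_lt_roomStop W z m htτ).trans htL)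

/-- The height at the stopped time `t ∧ τ^{z,m}` is at least `Im z/(m+1)`. [folklore] -/
theorem div_le_im_centredMap_min_roomStop (hW : Continuous W) (hz : 0 < z.im) (m : ℕ) (t : ℝ≥0) :
    z.im / ((m : ℝ) + 1) ≤ (centredMap W
      (min t (sInf ({u : ℝ≥0 | (centredMap W u z).im ≤ z.im / ((m : ℝ) + 1)} ∪ {(m : ℝ≥0) + 1})))
        z).im :=
  div_le_im_centredMap_of_le_roomStop hW hz m (min_le_right _ _)

/-! ### Boundedness of the stopped room–entropy combination -/

/-- **`0 ≤ log ψ_{t ∧ τ} ≤ 2 log (m+1)`**: before the room stop the flow is alive, `ψ ≥ 1`, and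
`ψ ≤ (Im z/Im z_·)² ≤ (m+1)²`. [cite: RohdeSchramm2005, eq. (6.3)] -/
theorem log_derivRatio_min_roomStop_mem_Icc (hW : Continuous W) (hz : 0 < z.im) (m : ℕ)
    (t : ℝ≥0) :
    Real.log (derivRatio W z
      (min t (sInf ({u : ℝ≥0 | (centredMap W u z).im ≤ z.im / ((m : ℝ) + 1)} ∪ {(m : ℝ≥0) + 1})))) ∈
      Icc (0 : ℝ) (2 * Real.log ((m : ℝ) + 1)) := by
  set τ := sInf ({u : ℝ≥0 | (centredMap W u z).im ≤ z.im / ((m : ℝ) + 1)} ∪ {(m : ℝ≥0) + 1})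
    with hτdef
  set r := min t τ with hr
  have hrτ : r ≤ τ := min_le_right _ _
  have hrT : (r : WithTop ℝ≥0) < swallowingTime W z := coe_lt_swallowingTime_of_le_roomStop hW hz m hrτ
  have hy : z.im / ((m : ℝ) + 1) ≤ (centredMap W r z).im :=
    div_le_im_centredMap_of_le_roomStop hW hz m hrτ
  have hm1 : (0 : ℝ) < (m : ℝ) + 1 := by positivity
  have hypos : 0 < (centredMap W r z).im := im_centredMap_pos hW hz hrT
  refine ⟨Real.log_nonneg (one_le_derivRatio hW hz hrT), ?_⟩
  have h1 := log_derivRatio_le_two_mul hW hz hrT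
  have h2 : Real.log z.im - Real.log (centredMap W r z).im ≤ Real.log ((m : ℝ) + 1) := by
    rw [← Real.log_div hz.ne' hypos.ne']
    refine Real.log_le_log (div_pos hz hypos) ?_
    rw [div_le_iff₀ hypos]
    rw [div_le_iff₀ hm1] at hy
    linarith
  linarith

/-- **The stopped room–entropy combination is bounded**: for every continuous driving function,
`z ∈ ℍ`, cap `m` and time `t`,
`0 ≤ log ψ_{t ∧ τ} + 3 H(S_{t ∧ τ}) ≤ 2 log (m+1) + 3 log 2` (`τ = τ^{z,m}` the room stop;
`0 ≤ H ≤ log 2` on `[0, 1]` and `S ∈ [0, 1]`, `schrammObs_mem_Icc`). This is the integrability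
input of every martingale statement about the stopped combination. [folklore] -/
theorem roomObs_min_roomStop_mem_Icc (hW : Continuous W) (hz : 0 < z.im) (m : ℕ) (t : ℝ≥0) :
    Real.log (derivRatio W z
        (min t (sInf ({u : ℝ≥0 | (centredMap W u z).im ≤ z.im / ((m : ℝ) + 1)} ∪ {(m : ℝ≥0) + 1})))) +
      3 * Real.binEntropy (schrammObs W z
        (min t (sInf ({u : ℝ≥0 | (centredMap W u z).im ≤ z.im / ((m : ℝ) + 1)} ∪ {(m : ℝ≥0) + 1})))) ∈
      Icc (0 : ℝ) (2 * Real.log ((m : ℝ) + 1) + 3 * Real.log 2) := by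
  obtain ⟨hl, hu⟩ := log_derivRatio_min_roomStop_mem_Icc hW hz m t
  set r := min t (sInf ({u : ℝ≥0 | (centredMap W u z).im ≤ z.im / ((m : ℝ) + 1)} ∪ {(m : ℝ≥0) + 1}))
    with hr
  obtain ⟨hS0, hS1⟩ := schrammObs_mem_Icc W z r
  have hH0 : 0 ≤ Real.binEntropy (schrammObs W z r) := Real.binEntropy_nonneg hS0 hS1
  have hH1 : Real.binEntropy (schrammObs W z r) ≤ Real.log 2 := Real.binEntropy_le_log_two
  constructor <;> nlinarith

/-- `|log ψ_{t ∧ τ} + 3 H(S_{t ∧ τ})| ≤ 2 log (m+1) + 3 log 2`. [folklore] -/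
theorem abs_roomObs_min_roomStop_le (hW : Continuous W) (hz : 0 < z.im) (m : ℕ) (t : ℝ≥0) :
    |Real.log (derivRatio W z
        (min t (sInf ({u : ℝ≥0 | (centredMap W u z).im ≤ z.im / ((m : ℝ) + 1)} ∪ {(m : ℝ≥0) + 1})))) +
      3 * Real.binEntropy (schrammObs W z
        (min t (sInf ({u : ℝ≥0 | (centredMap W u z).im ≤ z.im / ((m : ℝ) + 1)} ∪ {(m : ℝ≥0) + 1}))))| ≤
      2 * Real.log ((m : ℝ) + 1) + 3 * Real.log 2 := by
  obtain ⟨hl, hu⟩ := roomObs_min_roomStop_mem_Icc hW hz m t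
  rw [abs_of_nonneg hl]
  exact hu

end RoomStop

end Loewner

end Literature.Probability.RandomPlanarGeometry
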